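import Literature.NumberTheory.ConnesConsani2021.EpsSlopeTailFrame
import Literature.NumberTheory.ConnesConsani2021.ProlateTraceIdentities
import Literature.NumberTheory.ConnesConsani2021.ProlateProjectionsCompleteness
import HarnessLib

/-!
# Connes–Consani 2021, Remark 4.6 (i) pointwise: `Σ_n λ(n)² ξ_n(1)² = 2` from the completeness of the `ξ_n`
# (Parseval against the cut-off cosine wave; PROVED modulo the ONE named fact `CC2021_sec4_xi_complete`)

LINE 1 — FRAMING: RH-FREE corpus literature (Slepian-basis Parseval identity at the endpoint `y = 1`);
cell rh-crit, corpus C1, seat t12 g2 (free-seat discharge of a fact typed by t3 in `ProlateProjections.lean`);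
bears_on: W-C/W-P (§4 support computation, no leaf role).  WHAT THIS IS NOT: any claim about RH —
nothing in this file mentions `ζ`, the critical strip or RH, and nothing here bears on the truth of RH.

Source: A. Connes, C. Consani, *Weil positivity and trace formula, the archimedean place*, Selecta
Math. (N.S.) 27 (2021) 77 = arXiv:2006.13771 [bib `ConnesConsani2021`], Remark 4.6 (i) §4 p. 18
(arXiv item Remark 26, chunk p0018:L5–L15): "`Σ λ(n)² ξ_n(1)² = 2`" (in CC's pointwise normalisation
`ξ_n = √2·h_{2n,1}`; equivalently `Σ λ(n)² h_{2n,1}(1)² = 1`), typed by seat t3 as the named fact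
`CC2021_rem_4_6_i_pointwise : HasSum (fun n ↦ λ(n)² (√2·prolateFun n 1)²) 2`.

## What is here (theorems only: 0 definitions, 0 named facts)

* `cutoffCosWave_mem_evenPart`, `cutoffProj_cutoffCosWave` — the cut-off cosine wave
  `c_y = 1_{[−1,1]} cos(2πy·)` of `EpsSlopeTailFrame.lean` is even and lies in the range of `𝒫₁`;
* **`hasSum_sq_prolateEigen_mul_sq_of_xi_complete`** — PARSEVAL: if the `ξ_n` are complete in
  `𝒫₁ L²(ℝ)_ev` (`CC2021_sec4_xi_complete`), then for `y ∈ [−1,1]`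
  `Σ_n λ(n)² ψ_n(y)² = ‖c_y‖²` (`= 1 + cos 2πy sin 2πy/(2πy)` for `y ≠ 0`,
  `hasSum_sq_prolateEigen_mul_sq_eq_of_xi_complete`): the expansion `𝒫₁x = Σ⟨ξ_n|x⟩ξ_n` of seat t2's
  `hasSum_inner_smul_prolateXi_of_xi_complete` at `x = c_y`, paired with `c_y`, and
  `⟨c_y|ξ_n⟩ = η̃_n(y) = λ(n)ψ_n(y)` (eq. (74)/(cosalphan), tree `cosTransform_prolateFun_eq`) — the
  equality case of gm-t16's Bessel inequality `sum_sq_prolateEigen_mul_sq_le_cos`;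
* **`CC2021_rem_4_6_i_pointwise_of_xi_complete : CC2021_sec4_xi_complete → CC2021_rem_4_6_i_pointwise`**
  — at `y = 1`, `‖c_1‖² = 1 + cos 2π sin 2π/(2π) = 1`.

Deviation from print (a shorter road the tree already paves): the printed argument derives the identity
from `δ′(1⁺) = 1` (eq. (sch18.5) of §2) by differentiating the trace identity (chirem1) at `ρ = 1⁺` and
`ψ_n(1) = λ(n)ξ_n(1)`; here it is the diagonal value at `(1,1)` of the expansion of the kernel of
`𝒫₁𝒫̂₁𝒫₁|_{ev}` in the orthonormal basis `(ξ_n)`, i.e. Parseval for the vector `c_1`, which needs exactly the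
same completeness input (`CC2021_sec4_xi_complete`, in discharge by seats t3/t10) and nothing about `δ`.
* **`CC2021_rem_4_6_i_pointwise_holds : CC2021_rem_4_6_i_pointwise`** — the DISCHARGE (fact → theorem),
  feeding seat t10's `CC2021_sec4_xi_complete_holds` (module `ProlateProjectionsCompleteness`, the
  Slepian–Pollak completeness of the `ξ_n`, landed 2026-08-26) into the conditional theorem.
-/

noncomputable section

open Real MeasureTheory Set Filter Complex
open scoped InnerProductSpace ComplexConjugate

namespace Literature.NumberTheory.ConnesConsani2021

open Literature.NumberTheory.LFunctions

/-! ## The cut-off cosine wave lies in `𝒫₁ L²(ℝ)_ev` -/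

/-- `c_y = 1_{[−1,1]} cos(2πy·)` is even. [cite: ConnesConsani2021, Prop. 4.5 (iii) proof §4 p. 17 (arXiv p0017:L26)] -/
theorem cutoffCosWave_mem_evenPart (y : ℝ) : (memLp_cutoffCosWave y).toLp _ ∈ evenPart := by
  rw [mem_evenPart_iff]
  have h := MemLp.coeFn_toLp (memLp_cutoffCosWave y)
  filter_upwards [h,
    (Measure.measurePreserving_neg (volume : Measure ℝ)).quasiMeasurePreserving.ae_eq_comp h]
    with x hx hx'
  simp only [Function.comp_apply] at hx'
  rw [hx', hx]
  by_cases hxI : x ∈ Icc (-1 : ℝ) 1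
  · have hxI' : -x ∈ Icc (-1 : ℝ) 1 := ⟨by linarith [hxI.2], by linarith [hxI.1]⟩
    rw [indicator_of_mem hxI, indicator_of_mem hxI',
      show 2 * π * -x * y = -(2 * π * x * y) by ring, Real.cos_neg]
  · have hxI' : -x ∉ Icc (-1 : ℝ) 1 := fun h' => hxI ⟨by linarith [h'.2], by linarith [h'.1]⟩
    rw [indicator_of_notMem hxI, indicator_of_notMem hxI']

/-- `𝒫₁ c_y = c_y` (`c_y` is supported in `[−1,1]`). [cite: ConnesConsani2021, Prop. 4.5 (iii) proof §4 p. 17 (arXiv p0017:L26)] -/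
theorem cutoffProj_cutoffCosWave (y : ℝ) :
    cutoffProj 1 ((memLp_cutoffCosWave y).toLp _) = (memLp_cutoffCosWave y).toLp _ := by
  apply Lp.ext
  filter_upwards [cutoffProj_coeFn 1 ((memLp_cutoffCosWave y).toLp _),
    MemLp.coeFn_toLp (memLp_cutoffCosWave y)] with x h1 h2
  rw [h1]
  by_cases hx : x ∈ Icc (-1 : ℝ) 1
  · rw [indicator_of_mem hx]
  · rw [indicator_of_notMem hx, h2, indicator_of_notMem hx]

/-! ## Parseval against `c_y` from the completeness of the `ξ_n` -/

/-- **Parseval against the cosine wave, from completeness**: if the `ξ_n` form an orthonormal basis of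
`𝒫₁L²(ℝ)_ev` (`CC2021_sec4_xi_complete`), then for `y ∈ [−1,1]`
`Σ_n λ(n)² ψ_n(y)² = Σ_n |⟨ξ_n|c_y⟩|² = ‖c_y‖²` — the equality case of the Bessel inequality
`sum_sq_prolateEigen_mul_sq_le_cos`. [cite: ConnesConsani2021, Remark 4.6 (i) §4 p. 18 (arXiv item Remark 26, p0018:L5–L15); Prop. 4.5 (iii) proof p. 17 (arXiv p0017:L26)] -/
theorem hasSum_sq_prolateEigen_mul_sq_of_xi_complete (h : CC2021_sec4_xi_complete) {y : ℝ}
    (hy : y ∈ Icc (-1 : ℝ) 1) :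
    HasSum (fun n : ℕ ↦ prolateEigen n ^ 2 * prolateFun n y ^ 2)
      (‖(memLp_cutoffCosWave y).toLp _‖ ^ 2) := by
  set c : Lp ℂ 2 (volume : Measure ℝ) := (memLp_cutoffCosWave y).toLp _ with hc
  have hs := hasSum_inner_smul_prolateXi_of_xi_complete h (cutoffCosWave_mem_evenPart y)
  rw [cutoffProj_cutoffCosWave] at hs
  -- pair the expansion `c = Σ ⟨ξ_n|c⟩ ξ_n` with `c`
  have h2 := hs.mapL (innerSL ℂ c)
  have hterm : ∀ n : ℕ, innerSL ℂ c (⟪prolateXi n, c⟫_ℂ • prolateXi n) =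
      ((prolateEigen n ^ 2 * prolateFun n y ^ 2 : ℝ) : ℂ) := by
    intro n
    rw [innerSL_apply_apply, inner_smul_right, ← inner_conj_symm (prolateXi n) c, hc,
      inner_cutoffCosWave_prolateXi, cosTransform_prolateFun_eq hy, Complex.conj_ofReal]
    push_cast
    ring
  have e : (fun n : ℕ ↦ innerSL ℂ c (⟪prolateXi n, c⟫_ℂ • prolateXi n)) =
      fun n : ℕ ↦ ((prolateEigen n ^ 2 * prolateFun n y ^ 2 : ℝ) : ℂ) := funext hterm
  have h3 : HasSum (fun n : ℕ ↦ ((prolateEigen n ^ 2 * prolateFun n y ^ 2 : ℝ) : ℂ)) ⟪c, c⟫_ℂ := by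
    rw [← e, ← innerSL_apply_apply (𝕜 := ℂ)]
    exact h2
  have h4 : ⟪c, c⟫_ℂ = ((‖c‖ ^ 2 : ℝ) : ℂ) := by
    rw [inner_self_eq_norm_sq_to_K]; norm_cast
  rw [h4] at h3
  exact Complex.hasSum_ofReal.1 h3

/-- The same with the norm evaluated: for `y ∈ [−1,1]`, `y ≠ 0`,
`Σ_n λ(n)² ψ_n(y)² = 1 + cos(2πy) sin(2πy)/(2πy)` (`= 1 + sin(4πy)/(4πy)`, the diagonal of the expansion of
the kernel of `𝒫₁𝒫̂₁𝒫₁|_{ev}` in the basis `(ξ_n)`). [cite: ConnesConsani2021, Remark 4.6 (i) §4 p. 18 (arXiv item Remark 26, p0018:L5–L15); §4 p. 16 (arXiv p0016:L22–L28)] -/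
theorem hasSum_sq_prolateEigen_mul_sq_eq_of_xi_complete (h : CC2021_sec4_xi_complete) {y : ℝ}
    (hy : y ∈ Icc (-1 : ℝ) 1) (hy0 : y ≠ 0) :
    HasSum (fun n : ℕ ↦ prolateEigen n ^ 2 * prolateFun n y ^ 2)
      (1 + Real.cos (2 * π * y) * Real.sin (2 * π * y) / (2 * π * y)) := by
  rw [← norm_cutoffCosWave_sq hy0]
  exact hasSum_sq_prolateEigen_mul_sq_of_xi_complete h hy

/-- **Remark 4.6 (i), pointwise, from completeness**:
`CC2021_sec4_xi_complete → CC2021_rem_4_6_i_pointwise`, i.e. `Σ_n λ(n)² (√2 ψ_n(1))² = 2`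
(`‖c_1‖² = 1 + cos 2π sin 2π/(2π) = 1`). [cite: ConnesConsani2021, Remark 4.6 (i) §4 p. 18 (arXiv item Remark 26, p0018:L5–L15)] -/
theorem CC2021_rem_4_6_i_pointwise_of_xi_complete (h : CC2021_sec4_xi_complete) :
    CC2021_rem_4_6_i_pointwise := by
  have h1 := hasSum_sq_prolateEigen_mul_sq_eq_of_xi_complete h (y := 1) ⟨by norm_num, le_rfl⟩
    one_ne_zero
  rw [mul_one, Real.sin_two_pi, mul_zero, zero_div, add_zero] at h1
  have h2 := h1.mul_left 2
  rw [mul_one] at h2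
  have e : (fun n : ℕ ↦ prolateEigen n ^ 2 * (Real.sqrt 2 * prolateFun n 1) ^ 2) =
      fun n : ℕ ↦ 2 * (prolateEigen n ^ 2 * prolateFun n 1 ^ 2) := by
    funext n
    rw [mul_pow, Real.sq_sqrt (by norm_num : (0 : ℝ) ≤ 2)]
    ring
  change HasSum (fun n : ℕ ↦ prolateEigen n ^ 2 * (Real.sqrt 2 * prolateFun n 1) ^ 2) 2
  rw [e]
  exact h2

/-- **Remark 4.6 (i), pointwise — DISCHARGED**: `Σ_n λ(n)² (√2 ψ_n(1))² = 2` is a theorem, the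
completeness of the `ξ_n` (`CC2021_sec4_xi_complete_holds`, seat t10, Slepian–Pollak 1961 §III) fed into
`CC2021_rem_4_6_i_pointwise_of_xi_complete`. [cite: ConnesConsani2021, Remark 4.6 (i) §4 p. 18 (arXiv item Remark 26, p0018:L5–L15)] -/
theorem CC2021_rem_4_6_i_pointwise_holds : CC2021_rem_4_6_i_pointwise :=
  CC2021_rem_4_6_i_pointwise_of_xi_complete CC2021_sec4_xi_complete_holds

end Literature.NumberTheory.ConnesConsani2021

end
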